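import Literature.NumberTheory.LFunctions.PrimeNumberTheoremErrorTermProofs
import Mathlib.NumberTheory.Chebyshev
import Mathlib.NumberTheory.ArithmeticFunction.VonMangoldt
import Mathlib.Analysis.SpecialFunctions.Stirling
import Mathlib.Analysis.SumIntegralComparisons
import Mathlib.MeasureTheory.Function.Floor
import HarnessLib

/-!
# Halász's theorem, II: the partial-summation lemma (Granville–Soundararajan 2003, Lemma 2.1)

For completely multiplicative `1`-bounded `g` and `S(y) = ∑_{n ≤ y} g(n)`:
* (A1) `|S(y)| log y ≤ ∑_{d ≤ y} Λ(d) |S(y/d)| + y` and the signed form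
  `|S(y)| log y ≤ |∑_{n ≤ y} g(n) log n| + y` (from `log n = ∑_{d | n} Λ(d)` and
  `∑_{n ≤ y} log(y/n) ≤ y`, Stirling);
* (A2) `|S(x)| log x ≤ x ∫_{log 2}^{log x} |S(e^u)| e^{-u} du + C x` (`x ≥ 3`), i.e.
  Granville–Soundararajan's (2.1) `|S(x)|/x ≤ (1/log x) ∫_2^x |S(y)|/y² dy + O(1/log x)` in the
  variable `u = log y`, obtained from (A1) by Abel summation in `d`, using the prime number
  theorem with error `x/log² x` (`Literature.NumberTheory.LFunctions.ChebyshevThetaDeLaValleePoussin_holds.logPow` from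
  `PrimeNumberTheoremErrorTermProofs`) to replace `Λ(d)` by `1` on average.

## Main results
- `Literature.NumberTheory.LFunctions.Halasz.S` : the partial sums; `Literature.Halasz.normSExp g u = |S(e^u)| e^{-u}`.
- `Literature.NumberTheory.LFunctions.Halasz.norm_S_mul_log_le`, `Literature.NumberTheory.LFunctions.Halasz.norm_S_mul_log_le_norm_sum` : (A1).
- `Literature.NumberTheory.LFunctions.Halasz.exists_norm_S_mul_log_le_integral` : (A2).

## References
- [GranvilleSoundararajan2003] A. Granville, K. Soundararajan, *Decay of mean values of
  multiplicative functions*, Canad. J. Math. 55 (2003), Lemma 2.1.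
-/

noncomputable section

open Finset Real Complex MeasureTheory
open scoped ArithmeticFunction.vonMangoldt

namespace Literature.NumberTheory.LFunctions

namespace Halasz

/-- Partial sums `S(y) = ∑_{1 ≤ n ≤ y} g(n)`. [folklore] -/
def S (g : ℕ → ℂ) (y : ℝ) : ℂ := ∑ n ∈ Finset.Icc 1 ⌊y⌋₊, g n

variable {g : ℕ → ℂ}

/-- `S(y)` as a sum over `Ioc 0 ⌊y⌋`. [folklore] -/
theorem S_eq_sum_Ioc (g : ℕ → ℂ) (y : ℝ) : S g y = ∑ n ∈ Finset.Ioc 0 ⌊y⌋₊, g n := by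
  unfold S
  congr 1

/-- `S(y) = 0` for `y < 1`. [folklore] -/
theorem S_of_lt_one (g : ℕ → ℂ) {y : ℝ} (hy : y < 1) : S g y = 0 := by
  unfold S
  rcases lt_or_ge y 0 with h | h
  · rw [Nat.floor_of_nonpos h.le]; simp
  · rw [Nat.floor_eq_zero.mpr hy]; simp

/-- `|S(y)| ≤ ⌊y⌋` for `1`-bounded `g`. [folklore] -/
theorem norm_S_le (hgb : ∀ n, ‖g n‖ ≤ 1) (y : ℝ) : ‖S g y‖ ≤ ⌊y⌋₊ := by
  unfold S
  refine (norm_sum_le _ _).trans ?_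
  calc ∑ n ∈ Finset.Icc 1 ⌊y⌋₊, ‖g n‖ ≤ ∑ n ∈ Finset.Icc 1 ⌊y⌋₊, (1 : ℝ) := Finset.sum_le_sum fun n _ => hgb n
    _ = ⌊y⌋₊ := by simp

/-- `|S(y)| ≤ y` for `1`-bounded `g` and `y ≥ 0`. [folklore] -/
theorem norm_S_le' (hgb : ∀ n, ‖g n‖ ≤ 1) {y : ℝ} (hy : 0 ≤ y) : ‖S g y‖ ≤ y :=
  (norm_S_le hgb y).trans (Nat.floor_le hy)

/-- `‖S(y) - S(y')‖ ≤ ⌊y⌋ - ⌊y'⌋` for `y' ≤ y`. [folklore] -/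
theorem norm_S_sub_S_le (hgb : ∀ n, ‖g n‖ ≤ 1) {y y' : ℝ} (h : ⌊y'⌋₊ ≤ ⌊y⌋₊) :
    ‖S g y - S g y'‖ ≤ (⌊y⌋₊ : ℝ) - ⌊y'⌋₊ := by
  rw [S_eq_sum_Ioc, S_eq_sum_Ioc, ← Finset.sum_Ioc_consecutive _ (Nat.zero_le _) h, add_sub_cancel_left]
  refine (norm_sum_le _ _).trans ?_
  calc ∑ n ∈ Finset.Ioc ⌊y'⌋₊ ⌊y⌋₊, ‖g n‖ ≤ ∑ n ∈ Finset.Ioc ⌊y'⌋₊ ⌊y⌋₊, (1 : ℝ) := Finset.sum_le_sum fun n _ => hgb n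
    _ = (⌊y⌋₊ : ℝ) - ⌊y'⌋₊ := by simp [Nat.cast_sub h]

/-- `S` is measurable (a step function). [folklore] -/
theorem measurable_S (g : ℕ → ℂ) : Measurable (S g) :=
  (measurable_from_nat (f := fun k : ℕ => ∑ n ∈ Finset.Icc 1 k, g n)).comp Nat.measurable_floor

/-! ### Swapping a divisor sum -/

/-- `∑_{n ≤ Y} ∑_{d ∣ n} F(d, n) = ∑_{d ≤ Y} ∑_{m ≤ Y/d} F(d, dm)`. [folklore] -/
theorem sum_Icc_sum_divisors_eq {M : Type*} [AddCommMonoid M] (F : ℕ → ℕ → M) (Y : ℕ) :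
    ∑ n ∈ Finset.Icc 1 Y, ∑ d ∈ n.divisors, F d n =
      ∑ d ∈ Finset.Icc 1 Y, ∑ m ∈ Finset.Icc 1 (Y / d), F d (d * m) := by
  rw [Finset.sum_sigma', Finset.sum_sigma']
  refine Finset.sum_bij' (fun x _ => ⟨x.2, x.1 / x.2⟩) (fun x _ => ⟨x.1 * x.2, x.1⟩) ?_ ?_ ?_ ?_ ?_
  · rintro ⟨n, d⟩ hx
    simp only [Finset.mem_sigma, Finset.mem_Icc, Nat.mem_divisors] at hx ⊢
    obtain ⟨⟨hn1, hnY⟩, hdn, hn0⟩ := hx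
    have hd0 : 0 < d := Nat.pos_of_dvd_of_pos hdn (by omega)
    refine ⟨⟨hd0, (Nat.le_of_dvd (by omega) hdn).trans hnY⟩, ?_, Nat.div_le_div_right hnY⟩
    exact Nat.div_pos (Nat.le_of_dvd (by omega) hdn) hd0
  · rintro ⟨d, m⟩ hx
    simp only [Finset.mem_sigma, Finset.mem_Icc, Nat.mem_divisors] at hx ⊢
    obtain ⟨⟨hd1, hdY⟩, hm1, hmY⟩ := hx
    refine ⟨⟨Nat.mul_pos hd1 hm1, ?_⟩, Dvd.intro m rfl, (Nat.mul_pos hd1 hm1).ne'⟩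
    calc d * m ≤ d * (Y / d) := Nat.mul_le_mul_left d hmY
      _ ≤ Y := Nat.mul_div_le Y d
  · rintro ⟨n, d⟩ hx
    simp only [Finset.mem_sigma, Finset.mem_Icc, Nat.mem_divisors] at hx
    obtain ⟨⟨hn1, hnY⟩, hdn, hn0⟩ := hx
    simp only [Nat.mul_div_cancel' hdn]
  · rintro ⟨d, m⟩ hx
    simp only [Finset.mem_sigma, Finset.mem_Icc] at hx
    obtain ⟨⟨hd1, hdY⟩, hm1, hmY⟩ := hx
    simp only [Nat.mul_div_cancel_left m hd1]
  · rintro ⟨n, d⟩ hx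
    simp only [Finset.mem_sigma, Finset.mem_Icc, Nat.mem_divisors] at hx
    obtain ⟨⟨hn1, hnY⟩, hdn, hn0⟩ := hx
    simp only [Nat.mul_div_cancel' hdn]

/-! ### Lemma A1: `S(y) log y = ∑_{d ≤ y} Λ(d) g(d) S(y/d) + ∑_{n ≤ y} g(n) log(y/n)` -/

/-- `∑_{n ≤ y} g(n) log n = ∑_{d ≤ y} Λ(d) g(d) S(y/d)` for completely multiplicative `g`. [folklore] -/
theorem sum_mul_log_eq (hg : ∀ m n, g (m * n) = g m * g n) (y : ℝ) :
    ∑ n ∈ Finset.Icc 1 ⌊y⌋₊, g n * (Real.log n : ℂ) =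
      ∑ d ∈ Finset.Icc 1 ⌊y⌋₊, (Λ d : ℂ) * g d * S g (y / d) := by
  have h1 : ∀ n ∈ Finset.Icc 1 ⌊y⌋₊, g n * (Real.log n : ℂ) = ∑ d ∈ n.divisors, (Λ d : ℂ) * g n := by
    intro n _
    rw [← Finset.sum_mul, ← Complex.ofReal_sum, ArithmeticFunction.vonMangoldt_sum, mul_comm]
  rw [Finset.sum_congr rfl h1, sum_Icc_sum_divisors_eq (fun d n => (Λ d : ℂ) * g n)]
  refine Finset.sum_congr rfl fun d hd => ?_
  rw [Finset.mem_Icc] at hd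
  unfold S
  rw [Nat.floor_div_natCast, Finset.mul_sum]
  refine Finset.sum_congr rfl fun m _ => ?_
  rw [hg]; ring

/-- `∑_{1 ≤ n ≤ Y} log(y/n) ≤ y` for `y ≥ 1`, `Y = ⌊y⌋` (via `log Y! ≥ Y log Y - Y`). [folklore] -/
theorem sum_log_div_le {y : ℝ} (hy : 1 ≤ y) :
    ∑ n ∈ Finset.Icc 1 ⌊y⌋₊, Real.log (y / n) ≤ y := by
  set Y := ⌊y⌋₊ with hY
  have hY1 : 1 ≤ Y := Nat.le_floor (by simpa using hy)
  have hY0 : (0 : ℝ) < Y := by exact_mod_cast hY1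
  have hYy : (Y : ℝ) ≤ y := Nat.floor_le (by linarith)
  have hy0 : 0 < y := by linarith
  have hsplit : ∑ n ∈ Finset.Icc 1 Y, Real.log (y / n) = Y * Real.log y - Real.log (Y.factorial) := by
    rw [show Finset.Icc 1 Y = Finset.Ico 1 (Y + 1) by ext n; simp only [Finset.mem_Icc, Finset.mem_Ico]; omega,
      ← Finset.prod_Ico_id_eq_factorial, Nat.cast_prod, Real.log_prod]
    · rw [Finset.sum_congr rfl fun n hn => Real.log_div hy0.ne' (by
        rw [Finset.mem_Ico] at hn; exact_mod_cast (show n ≠ 0 by omega)), Finset.sum_sub_distrib]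
      simp
    · intro n hn
      rw [Finset.mem_Ico] at hn
      exact_mod_cast (show n ≠ 0 by omega)
  rw [hsplit]
  have hst := Stirling.le_log_factorial_stirling (n := Y) (by omega)
  have hlogY : 0 ≤ Real.log Y := Real.log_nonneg (by exact_mod_cast hY1)
  have h2π : 0 ≤ Real.log (2 * Real.pi) / 2 := by
    have : (1 : ℝ) ≤ 2 * Real.pi := by have := Real.pi_gt_three; linarith
    have := Real.log_nonneg this
    positivity
  have hfac : (Y : ℝ) * Real.log Y - Y ≤ Real.log (Y.factorial) := by linarith
  -- `Y log y - (Y log Y - Y) = Y log (y/Y) + Y ≤ Y (y/Y - 1) + Y = y`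
  have hlog : Real.log (y / Y) ≤ y / Y - 1 := by
    have := Real.log_le_sub_one_of_pos (by positivity : 0 < y / Y); linarith
  have hlog' : Real.log y - Real.log Y ≤ y / Y - 1 := by rwa [Real.log_div hy0.ne' hY0.ne'] at hlog
  have : (Y : ℝ) * (Real.log y - Real.log Y) ≤ Y * (y / Y - 1) := mul_le_mul_of_nonneg_left hlog' hY0.le
  have hYY : (Y : ℝ) * (y / Y - 1) = y - Y := by field_simp
  nlinarith

/-- **Lemma A1**: `‖S(y)‖ log y ≤ ∑_{d ≤ y} Λ(d) ‖S(y/d)‖ + y` (`y ≥ 1`, `g` completely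
multiplicative, `|g| ≤ 1`). [cite: GranvilleSoundararajan2003, Lemma 2.1, (2.3)–(2.4)] -/
theorem norm_S_mul_log_le (hg : ∀ m n, g (m * n) = g m * g n) (hgb : ∀ n, ‖g n‖ ≤ 1) {y : ℝ} (hy : 1 ≤ y) :
    ‖S g y‖ * Real.log y ≤ ∑ d ∈ Finset.Icc 1 ⌊y⌋₊, Λ d * ‖S g (y / d)‖ + y := by
  have hy0 : 0 < y := by linarith
  -- `S(y) log y = ∑ g(n) log n + ∑ g(n) log(y/n)`
  have hdec : S g y * (Real.log y : ℂ) = ∑ n ∈ Finset.Icc 1 ⌊y⌋₊, g n * (Real.log n : ℂ) +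
      ∑ n ∈ Finset.Icc 1 ⌊y⌋₊, g n * (Real.log (y / n) : ℂ) := by
    unfold S
    rw [Finset.sum_mul, ← Finset.sum_add_distrib]
    refine Finset.sum_congr rfl fun n hn => ?_
    rw [Finset.mem_Icc] at hn
    have hn0 : (0 : ℝ) < n := by exact_mod_cast hn.1
    rw [← mul_add, ← Complex.ofReal_add, Real.log_div hy0.ne' hn0.ne']
    ring_nf
  have hnorm : ‖S g y‖ * Real.log y = ‖S g y * (Real.log y : ℂ)‖ := by
    rw [norm_mul, Complex.norm_real, Real.norm_of_nonneg (Real.log_nonneg hy)]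
  rw [hnorm, hdec]
  refine (norm_add_le _ _).trans (add_le_add ?_ ?_)
  · rw [sum_mul_log_eq hg y]
    refine (norm_sum_le _ _).trans (Finset.sum_le_sum fun d _ => ?_)
    rw [norm_mul, norm_mul, Complex.norm_real, Real.norm_of_nonneg ArithmeticFunction.vonMangoldt_nonneg]
    calc Λ d * ‖g d‖ * ‖S g (y / d)‖ ≤ Λ d * 1 * ‖S g (y / d)‖ :=
          mul_le_mul_of_nonneg_right (mul_le_mul_of_nonneg_left (hgb d) ArithmeticFunction.vonMangoldt_nonneg)
            (norm_nonneg _)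
      _ = Λ d * ‖S g (y / d)‖ := by ring
  · refine (norm_sum_le _ _).trans ?_
    refine le_trans (Finset.sum_le_sum fun n hn => ?_) (sum_log_div_le hy)
    rw [Finset.mem_Icc] at hn
    have hn0 : (0 : ℝ) < n := by exact_mod_cast hn.1
    have hlog : 0 ≤ Real.log (y / n) := Real.log_nonneg (by
      rw [le_div_iff₀ hn0, one_mul]; exact le_trans (by exact_mod_cast hn.2) (Nat.floor_le hy0.le))
    rw [norm_mul, Complex.norm_real, Real.norm_of_nonneg hlog]
    exact mul_le_of_le_one_left hlog (hgb n)


/-- **Lemma A1, signed form**: `‖S(y)‖ log y ≤ ‖∑_{n ≤ y} g(n) log n‖ + y` (`y ≥ 1`, `|g| ≤ 1`).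
[cite: GranvilleSoundararajan2003, proof of Lemma 2.1] -/
theorem norm_S_mul_log_le_norm_sum (hgb : ∀ n, ‖g n‖ ≤ 1) {y : ℝ} (hy : 1 ≤ y) :
    ‖S g y‖ * Real.log y ≤ ‖∑ n ∈ Finset.Icc 1 ⌊y⌋₊, g n * (Real.log n : ℂ)‖ + y := by
  have hy0 : 0 < y := by linarith
  have hdec : S g y * (Real.log y : ℂ) = ∑ n ∈ Finset.Icc 1 ⌊y⌋₊, g n * (Real.log n : ℂ) +
      ∑ n ∈ Finset.Icc 1 ⌊y⌋₊, g n * (Real.log (y / n) : ℂ) := by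
    unfold S
    rw [Finset.sum_mul, ← Finset.sum_add_distrib]
    refine Finset.sum_congr rfl fun n hn => ?_
    rw [Finset.mem_Icc] at hn
    have hn0 : (0 : ℝ) < n := by exact_mod_cast hn.1
    rw [← mul_add, ← Complex.ofReal_add, Real.log_div hy0.ne' hn0.ne']
    ring_nf
  have hnorm : ‖S g y‖ * Real.log y = ‖S g y * (Real.log y : ℂ)‖ := by
    rw [norm_mul, Complex.norm_real, Real.norm_of_nonneg (Real.log_nonneg hy)]
  rw [hnorm, hdec]
  refine (norm_add_le _ _).trans (add_le_add le_rfl ?_)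
  refine (norm_sum_le _ _).trans ?_
  refine le_trans (Finset.sum_le_sum fun n hn => ?_) (sum_log_div_le hy)
  rw [Finset.mem_Icc] at hn
  have hn0 : (0 : ℝ) < n := by exact_mod_cast hn.1
  have hlog : 0 ≤ Real.log (y / n) := Real.log_nonneg (by
    rw [le_div_iff₀ hn0, one_mul]; exact le_trans (by exact_mod_cast hn.2) (Nat.floor_le hy0.le))
  rw [norm_mul, Complex.norm_real, Real.norm_of_nonneg hlog]
  exact mul_le_of_le_one_left hlog (hgb n)

/-! ### Lemma A2: from `∑ Λ(d) ‖S(x/d)‖` to an integral (PNT partial summation) -/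

/-- Abel summation: `∑_{d=1}^{Y} (u_d - u_{d-1}) a_d = ∑_{d=1}^{Y} u_d (a_d - a_{d+1}) + u_Y a_{Y+1} - u_0 a_1`.
[folklore] -/
theorem abel_sum (u a : ℕ → ℝ) (Y : ℕ) :
    ∑ d ∈ Finset.Icc 1 Y, (u d - u (d - 1)) * a d =
      ∑ d ∈ Finset.Icc 1 Y, u d * (a d - a (d + 1)) + u Y * a (Y + 1) - u 0 * a 1 := by
  induction Y with
  | zero => simp
  | succ Y ih =>
    rw [Finset.sum_Icc_succ_top (by omega), Finset.sum_Icc_succ_top (by omega), ih]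
    simp only [Nat.add_sub_cancel]
    ring

/-- `∑_{d=a}^{b} d (F_d - F_{d+1}) = a F_a - (b+1) F_{b+1} + ∑_{d=a+1}^{b+1} F_d` (`a ≤ b + 1`). [folklore] -/
theorem abel_sum_id (F : ℕ → ℝ) (a : ℕ) : ∀ b : ℕ, a ≤ b + 1 →
    ∑ d ∈ Finset.Icc a b, (d : ℝ) * (F d - F (d + 1)) =
      a * F a - (b + 1) * F (b + 1) + ∑ d ∈ Finset.Icc (a + 1) (b + 1), F d := by
  intro b hab
  induction b with
  | zero =>
    rcases Nat.le_one_iff_eq_zero_or_eq_one.mp hab with rfl | rfl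
    · simp
    · simp
  | succ b ih =>
    rcases Nat.lt_or_ge (b + 1) a with h | h
    · -- `a = b + 2`: both sides vanish
      have ha : a = b + 1 + 1 := by omega
      subst ha
      rw [Finset.Icc_eq_empty (by omega), Finset.Icc_eq_empty (by omega)]
      push_cast
      ring
    · rw [Finset.sum_Icc_succ_top (by omega : a ≤ b + 1), ih h]
      conv_rhs => rw [Finset.sum_Icc_succ_top (by omega : a + 1 ≤ b + 1 + 1)]
      push_cast
      ring

/-- Telescoping: `∑_{d=1}^{Y} (F_d - F_{d+1}) = F_1 - F_{Y+1}`. [folklore] -/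
theorem sum_Icc_sub_succ (F : ℕ → ℝ) (Y : ℕ) :
    ∑ d ∈ Finset.Icc 1 Y, (F d - F (d + 1)) = F 1 - F (Y + 1) := by
  induction Y with
  | zero => simp
  | succ Y ih => rw [Finset.sum_Icc_succ_top (by omega), ih]; ring

variable {x : ℝ}

/-- The integer-count `k_d = ⌊x/d⌋ - ⌊x/(d+1)⌋ ≥ 0`. [folklore] -/
def kk (x : ℝ) (d : ℕ) : ℝ := (⌊x / d⌋₊ : ℝ) - ⌊x / (d + 1)⌋₊

/-- `⌊x/(d+1)⌋ ≤ ⌊x/d⌋`. [folklore] -/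
theorem floor_div_succ_le (hx : 0 ≤ x) {d : ℕ} (hd : 1 ≤ d) : ⌊x / (d + 1)⌋₊ ≤ ⌊x / d⌋₊ :=
  Nat.floor_le_floor (div_le_div_of_nonneg_left hx (by exact_mod_cast hd) (by linarith))

/-- `kk x d ≥ 0`. [folklore] -/
theorem kk_nonneg (hx : 0 ≤ x) {d : ℕ} (hd : 1 ≤ d) : 0 ≤ kk x d := by
  unfold kk
  have := floor_div_succ_le hx hd
  exact sub_nonneg.mpr (by exact_mod_cast this)

/-- `kk x d ≤ x/(d(d+1)) + 1`. [folklore] -/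
theorem kk_le (hx : 0 ≤ x) {d : ℕ} (hd : 1 ≤ d) : kk x d ≤ x / (d * (d + 1)) + 1 := by
  unfold kk
  have hd0 : (0 : ℝ) < d := by exact_mod_cast hd
  have h1 : (⌊x / d⌋₊ : ℝ) ≤ x / d := Nat.floor_le (by positivity)
  have h2 : x / (d + 1) - 1 ≤ ⌊x / (d + 1)⌋₊ := by
    have := Nat.lt_floor_add_one (x / (d + 1))
    linarith
  have h3 : x / d - x / (d + 1) = x / (d * (d + 1)) := by field_simp; ring
  linarith

/-- `∑_{d ≤ ⌊x⌋} kk x d = ⌊x⌋` (telescoping). [folklore] -/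
theorem sum_kk_eq (Y : ℕ) (hY : Y = ⌊x⌋₊) : ∑ d ∈ Finset.Icc 1 Y, kk x d = Y := by
  have h := sum_Icc_sub_succ (fun d : ℕ => (⌊x / d⌋₊ : ℝ)) Y
  simp only [Nat.cast_add, Nat.cast_one] at h
  unfold kk
  rw [h]
  have h1 : ⌊x / (1 : ℝ)⌋₊ = Y := by rw [div_one, hY]
  have h2 : ⌊x / ((Y : ℝ) + 1)⌋₊ = 0 := by
    rw [Nat.floor_eq_zero, div_lt_one (by positivity), hY]
    exact Nat.lt_floor_add_one x
  rw [h2]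
  norm_num at h1 ⊢
  rw [h1]

/-- `|‖S(x/d)‖ - ‖S(x/(d+1))‖| ≤ k_d`. [folklore] -/
theorem abs_norm_S_sub_le (hgb : ∀ n, ‖g n‖ ≤ 1) (hx : 0 ≤ x) {d : ℕ} (hd : 1 ≤ d) :
    |‖S g (x / d)‖ - ‖S g (x / (d + 1))‖| ≤ kk x d := by
  have h := norm_S_sub_S_le hgb (floor_div_succ_le hx hd)
  have := abs_norm_sub_norm_le (S g (x / d)) (S g (x / (d + 1)))
  unfold kk
  linarith

/-- The PNT input: `|ψ(d) - d| ≤ C₂ d / log² d` for `d ≥ 2` (de la Vallée Poussin, proved in the tree),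
and the Chebyshev bound `|ψ(d) - d| ≤ 7 d` for all `d`. [folklore] -/
theorem exists_psi_sub_le :
    ∃ C₂ : ℝ, 0 ≤ C₂ ∧ ∀ d : ℕ, 2 ≤ d → |Chebyshev.psi d - d| ≤ C₂ * d / Real.log d ^ 2 := by
  obtain ⟨C, hC⟩ := Literature.NumberTheory.LFunctions.ChebyshevThetaDeLaValleePoussin_holds.logPow 2
  refine ⟨max C 0 + 432, by positivity, fun d hd => ?_⟩
  have hd2 : (2 : ℝ) ≤ d := by exact_mod_cast hd
  have hd0 : (0 : ℝ) < d := by linarith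
  have hlog : 0 < Real.log d := Real.log_pos (by linarith)
  have h1 := hC d hd2
  rw [Real.rpow_two] at h1
  have h2 := Chebyshev.abs_psi_sub_theta_le_sqrt_mul_log (x := (d : ℝ)) (by linarith)
  -- `2 √d log d ≤ 432 d / log² d`, from `log d ≤ 6 d^{1/6}`
  have h3 : 2 * Real.sqrt d * Real.log d ≤ 432 * d / Real.log d ^ 2 := by
    have hl := Real.log_le_rpow_div hd0.le (by norm_num : (0:ℝ) < 1 / 6)
    rw [le_div_iff₀ (by positivity)]
    have hl3 : Real.log d ^ 3 ≤ 216 * (d : ℝ) ^ (1 / 2 : ℝ) := by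
      have : Real.log d ≤ 6 * (d : ℝ) ^ (1 / 6 : ℝ) := by
        calc Real.log d ≤ (d : ℝ) ^ (1 / 6 : ℝ) / (1 / 6) := hl
          _ = 6 * (d : ℝ) ^ (1 / 6 : ℝ) := by ring
      calc Real.log d ^ 3 ≤ (6 * (d : ℝ) ^ (1 / 6 : ℝ)) ^ 3 := pow_le_pow_left₀ hlog.le this 3
        _ = 216 * ((d : ℝ) ^ (1 / 6 : ℝ)) ^ (3 : ℕ) := by ring
        _ = 216 * (d : ℝ) ^ (1 / 2 : ℝ) := by
            rw [← Real.rpow_natCast, ← Real.rpow_mul hd0.le]; norm_num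
    have hsq : Real.sqrt d = (d : ℝ) ^ (1 / 2 : ℝ) := Real.sqrt_eq_rpow d
    have hdd : (d : ℝ) ^ (1 / 2 : ℝ) * (d : ℝ) ^ (1 / 2 : ℝ) = d := by
      rw [← Real.rpow_add hd0]; norm_num
    calc 2 * Real.sqrt d * Real.log d * Real.log d ^ 2 = 2 * (d : ℝ) ^ (1 / 2 : ℝ) * Real.log d ^ 3 := by
          rw [hsq]; ring
      _ ≤ 2 * (d : ℝ) ^ (1 / 2 : ℝ) * (216 * (d : ℝ) ^ (1 / 2 : ℝ)) := by gcongr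
      _ = 432 * ((d : ℝ) ^ (1 / 2 : ℝ) * (d : ℝ) ^ (1 / 2 : ℝ)) := by ring
      _ = 432 * d := by rw [hdd]
  have hC' : C * d / Real.log d ^ 2 ≤ max C 0 * d / Real.log d ^ 2 := by
    gcongr; exact le_max_left _ _
  calc |Chebyshev.psi d - d| ≤ |Chebyshev.psi d - Chebyshev.theta d| + |Chebyshev.theta d - d| := by
        have := abs_sub_le (Chebyshev.psi d) (Chebyshev.theta d) d; linarith
    _ ≤ 2 * Real.sqrt d * Real.log d + C * d / Real.log d ^ 2 := add_le_add h2 h1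
    _ ≤ 432 * d / Real.log d ^ 2 + max C 0 * d / Real.log d ^ 2 := add_le_add h3 hC'
    _ = (max C 0 + 432) * d / Real.log d ^ 2 := by ring

/-- Crude Chebyshev bound `|ψ(d) - d| ≤ 7d`. [folklore] -/
theorem abs_psi_sub_le_mul (d : ℕ) : |Chebyshev.psi d - d| ≤ 7 * d := by
  have h1 := Chebyshev.psi_le_const_mul_self (x := (d : ℝ)) (Nat.cast_nonneg d)
  have h2 := Chebyshev.psi_nonneg (d : ℝ)
  have hlog4 : Real.log 4 < 2 := by
    have h2 : Real.log 4 = 2 * Real.log 2 := by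
      rw [show (4:ℝ) = 2^2 by norm_num, Real.log_pow]; ring
    have := Real.log_two_lt_d9; linarith
  have hd : (0 : ℝ) ≤ d := Nat.cast_nonneg d
  rw [abs_le]
  constructor
  · linarith
  · nlinarith

/-- `∑_{d=2}^{D} 1/(d log² d) ≤ 3/log 2` (telescoping against `1/log d`). [folklore] -/
theorem sum_inv_mul_log_sq_le (D : ℕ) :
    ∑ d ∈ Finset.Icc 2 D, 1 / ((d : ℝ) * Real.log d ^ 2) ≤ 3 / Real.log 2 := by
  have hlog2 : (0.69 : ℝ) < Real.log 2 := by have := Real.log_two_gt_d9; linarith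
  have hterm : ∀ d ∈ Finset.Icc 2 D, 1 / ((d : ℝ) * Real.log d ^ 2) ≤
      3 * (1 / Real.log d - 1 / Real.log (d + 1)) := by
    intro d hd
    rw [Finset.mem_Icc] at hd
    have hd2 : (2 : ℝ) ≤ d := by exact_mod_cast hd.1
    have hd0 : (0 : ℝ) < d := by linarith
    have hld : Real.log 2 ≤ Real.log d := Real.log_le_log (by norm_num) hd2
    have hl0 : 0 < Real.log d := by linarith
    have hl1 : 0 < Real.log (d + 1) := Real.log_pos (by linarith)
    -- `log(d+1) - log d ≥ 1/(d+1)`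
    have hdiff : 1 / ((d : ℝ) + 1) ≤ Real.log (d + 1) - Real.log d := by
      have := Real.one_sub_inv_le_log_of_pos (x := ((d : ℝ) + 1) / d) (by positivity)
      rw [Real.log_div (by linarith) hd0.ne', inv_div] at this
      have e : 1 - (d : ℝ) / (d + 1) = 1 / (d + 1) := by field_simp; ring
      linarith
    -- `log (d+1) ≤ 2 log d`
    have hlsucc : Real.log (d + 1) ≤ 2 * Real.log d := by
      have : Real.log (d + 1) - Real.log d ≤ 1 / d := by
        have h := Real.log_le_sub_one_of_pos (x := ((d : ℝ) + 1) / d) (by positivity)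
        rw [Real.log_div (by linarith) hd0.ne'] at h
        have e : ((d : ℝ) + 1) / d - 1 = 1 / d := by field_simp; ring
        linarith
      have : 1 / (d : ℝ) ≤ 1 / 2 := one_div_le_one_div_of_le (by norm_num) hd2
      linarith
    have key : 1 / ((d : ℝ) * Real.log d ^ 2) ≤
        3 * ((Real.log (d + 1) - Real.log d) / (Real.log d * Real.log (d + 1))) := by
      rw [div_le_iff₀ (by positivity)]
      have h1 : 3 * ((Real.log (d + 1) - Real.log d) / (Real.log d * Real.log (d + 1))) * ((d : ℝ) * Real.log d ^ 2) =
          3 * (Real.log (d + 1) - Real.log d) * d * Real.log d / Real.log (d + 1) := by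
        field_simp
      rw [h1, le_div_iff₀ hl1]
      calc 1 * Real.log (d + 1) ≤ 2 * Real.log d := by linarith
        _ ≤ 3 * (1 / ((d : ℝ) + 1)) * d * Real.log d := by
            rw [show 3 * (1 / ((d : ℝ) + 1)) * d * Real.log d = (3 * d / (d + 1)) * Real.log d by
              field_simp]
            have : (2 : ℝ) ≤ 3 * d / (d + 1) := by rw [le_div_iff₀ (by positivity)]; linarith
            nlinarith
        _ ≤ 3 * (Real.log (d + 1) - Real.log d) * d * Real.log d := by gcongr
    calc 1 / ((d : ℝ) * Real.log d ^ 2) ≤ _ := key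
      _ = 3 * (1 / Real.log d - 1 / Real.log (d + 1)) := by rw [div_sub_div _ _ hl0.ne' hl1.ne']; ring
  refine (Finset.sum_le_sum hterm).trans ?_
  rw [← Finset.mul_sum]
  have htel : ∑ d ∈ Finset.Icc 2 D, (1 / Real.log d - 1 / Real.log ((d : ℝ) + 1)) ≤ 1 / Real.log 2 := by
    rcases Nat.lt_or_ge D 2 with hD | hD
    · rw [Finset.Icc_eq_empty (by omega)]; simp; positivity
    · have h := Finset.sum_range_sub' (fun i : ℕ => 1 / Real.log ((i : ℝ) + 2)) (D - 1)
      have heq : ∑ d ∈ Finset.Icc 2 D, (1 / Real.log d - 1 / Real.log ((d : ℝ) + 1)) =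
          ∑ i ∈ Finset.range (D - 1), (1 / Real.log ((i : ℝ) + 2) - 1 / Real.log (((i + 1 : ℕ) : ℝ) + 2)) := by
        rw [show Finset.Icc 2 D = Finset.Ico 2 (2 + (D - 1)) by
          ext d; simp only [Finset.mem_Icc, Finset.mem_Ico]; omega, Finset.sum_Ico_eq_sum_range,
          Nat.add_sub_cancel_left]
        refine Finset.sum_congr rfl fun i _ => ?_
        push_cast; ring_nf
      rw [heq, h]
      have : 0 ≤ 1 / Real.log (((D - 1 : ℕ) : ℝ) + 2) := by
        have h0 : (0 : ℝ) ≤ ((D - 1 : ℕ) : ℝ) := Nat.cast_nonneg _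
        have : 1 < ((D - 1 : ℕ) : ℝ) + 2 := by linarith
        have := Real.log_pos this
        positivity
      norm_num at this ⊢
      linarith
  have h3 : (0 : ℝ) ≤ 3 := by norm_num
  calc 3 * ∑ d ∈ Finset.Icc 2 D, (1 / Real.log d - 1 / Real.log ((d : ℝ) + 1)) ≤ 3 * (1 / Real.log 2) :=
        mul_le_mul_of_nonneg_left htel h3
    _ = 3 / Real.log 2 := by ring

/-- `∑_{d=m+1}^{n} 1/d ≤ log n - log m` for `1 ≤ m ≤ n`. [folklore] -/
theorem sum_Icc_inv_le_log (m n : ℕ) (hm : 1 ≤ m) (hmn : m ≤ n) :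
    ∑ d ∈ Finset.Icc (m + 1) n, 1 / (d : ℝ) ≤ Real.log n - Real.log m := by
  have hterm : ∀ d ∈ Finset.Icc (m + 1) n, 1 / (d : ℝ) ≤ Real.log d - Real.log ((d : ℝ) - 1) := by
    intro d hd
    rw [Finset.mem_Icc] at hd
    have hd1 : (1 : ℝ) < d := by exact_mod_cast (show 1 < d by omega)
    have hd0 : (0 : ℝ) < d - 1 := by linarith
    have := Real.one_sub_inv_le_log_of_pos (x := (d : ℝ) / (d - 1)) (by positivity)
    rw [Real.log_div (by linarith) hd0.ne', inv_div] at this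
    have e : 1 - ((d : ℝ) - 1) / d = 1 / d := by field_simp; ring
    linarith
  refine (Finset.sum_le_sum hterm).trans ?_
  have h := Finset.sum_range_sub (fun i : ℕ => Real.log ((i : ℝ) + m)) (n - m)
  have heq : ∑ d ∈ Finset.Icc (m + 1) n, (Real.log d - Real.log ((d : ℝ) - 1)) =
      ∑ i ∈ Finset.range (n - m), (Real.log (((i + 1 : ℕ) : ℝ) + m) - Real.log ((i : ℝ) + m)) := by
    rw [show Finset.Icc (m + 1) n = Finset.Ico (m + 1) (m + 1 + (n - m)) by
      ext d; simp only [Finset.mem_Icc, Finset.mem_Ico]; omega, Finset.sum_Ico_eq_sum_range,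
      Nat.add_sub_cancel_left]
    refine Finset.sum_congr rfl fun i _ => ?_
    push_cast; ring_nf
  rw [heq, h]
  have : (((n - m : ℕ) : ℝ) + m) = n := by
    rw [Nat.cast_sub hmn]; ring
  rw [this]; simp

/-- `ψ(d) - ψ(d-1) = Λ(d)` for `d ≥ 1`. [folklore] -/
theorem psi_sub_psi_pred {d : ℕ} (hd : 1 ≤ d) :
    Chebyshev.psi d - Chebyshev.psi ((d - 1 : ℕ) : ℝ) = Λ d := by
  rw [Chebyshev.psi_eq_sum_Icc, Chebyshev.psi_eq_sum_Icc, Nat.floor_natCast, Nat.floor_natCast]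
  obtain ⟨e, rfl⟩ : ∃ e, d = e + 1 := ⟨d - 1, by omega⟩
  rw [Nat.add_sub_cancel, Finset.sum_Icc_succ_top (Nat.zero_le _)]
  ring

/-- **Abel summation against the prime number theorem**: with `a_d = ‖S(x/d)‖`,
`∑_{d ≤ x} Λ(d) a_d ≤ ∑_{d ≤ x} a_d + ∑_{d ≤ x} |ψ(d) - d| k_d`. [cite: GranvilleSoundararajan2003, proof of Lemma 2.1] -/
theorem sum_vonMangoldt_mul_le (hgb : ∀ n, ‖g n‖ ≤ 1) (hx : 1 ≤ x) :
    ∑ d ∈ Finset.Icc 1 ⌊x⌋₊, Λ d * ‖S g (x / d)‖ ≤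
      ∑ d ∈ Finset.Icc 1 ⌊x⌋₊, ‖S g (x / d)‖ +
        ∑ d ∈ Finset.Icc 1 ⌊x⌋₊, |Chebyshev.psi d - d| * kk x d := by
  set Y := ⌊x⌋₊ with hY
  set a : ℕ → ℝ := fun d => ‖S g (x / d)‖ with ha
  have hx0 : 0 ≤ x := by linarith
  have haY : a (Y + 1) = 0 := by
    simp only [ha]
    rw [S_of_lt_one, norm_zero]
    rw [div_lt_one (by positivity), hY]
    exact_mod_cast Nat.lt_floor_add_one x
  -- Abel for `ψ` and for `id`
  have h1 := abel_sum (fun d : ℕ => Chebyshev.psi d) a Y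
  have h2 := abel_sum (fun d : ℕ => (d : ℝ)) a Y
  simp only [Nat.cast_zero, Chebyshev.psi_zero, zero_mul, sub_zero, haY, mul_zero, add_zero] at h1 h2
  have h1' : ∑ d ∈ Finset.Icc 1 Y, Λ d * a d =
      ∑ d ∈ Finset.Icc 1 Y, Chebyshev.psi d * (a d - a (d + 1)) := by
    rw [← h1]
    refine Finset.sum_congr rfl fun d hd => ?_
    rw [Finset.mem_Icc] at hd
    rw [psi_sub_psi_pred hd.1]
  have h2' : ∑ d ∈ Finset.Icc 1 Y, a d = ∑ d ∈ Finset.Icc 1 Y, (d : ℝ) * (a d - a (d + 1)) := by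
    rw [← h2]
    refine Finset.sum_congr rfl fun d hd => ?_
    rw [Finset.mem_Icc] at hd
    rw [Nat.cast_sub hd.1]; push_cast; ring
  rw [h1', h2', ← Finset.sum_add_distrib]
  refine Finset.sum_le_sum fun d hd => ?_
  rw [Finset.mem_Icc] at hd
  have hk := abs_norm_S_sub_le hgb hx0 hd.1
  have : (Chebyshev.psi d - d) * (a d - a (d + 1)) ≤ |Chebyshev.psi d - d| * kk x d := by
    calc (Chebyshev.psi d - d) * (a d - a (d + 1)) ≤ |(Chebyshev.psi d - d) * (a d - a (d + 1))| := le_abs_self _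
      _ = |Chebyshev.psi d - d| * |a d - a (d + 1)| := abs_mul _ _
      _ ≤ |Chebyshev.psi d - d| * kk x d := by
          gcongr
          simpa [ha] using hk
  linarith

/-- **The error term**: `∑_{d ≤ x} |ψ(d) - d| k_d ≤ C_E x` for `x ≥ 3`. [cite: GranvilleSoundararajan2003, proof of Lemma 2.1] -/
theorem exists_sum_abs_psi_sub_mul_kk_le :
    ∃ C : ℝ, ∀ x : ℝ, 3 ≤ x →
      ∑ d ∈ Finset.Icc 1 ⌊x⌋₊, |Chebyshev.psi d - d| * kk x d ≤ C * x := by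
  obtain ⟨C₂, hC₂, hpsi⟩ := exists_psi_sub_le
  refine ⟨7.5 + 16.5 * C₂, fun x hx => ?_⟩
  have hx0 : 0 < x := by linarith
  have hlog2 : (0.69 : ℝ) < Real.log 2 := by have := Real.log_two_gt_d9; linarith
  have hlog2' : Real.log 2 < 0.7 := by have := Real.log_two_lt_d9; linarith
  set Y := ⌊x⌋₊ with hY
  set D := ⌊Real.sqrt x⌋₊ with hD
  set L := Real.log x with hL
  have hL1 : 1 ≤ L := by
    rw [hL, ← Real.log_exp 1]
    exact Real.log_le_log (Real.exp_pos 1) (by have := Real.exp_one_lt_d9; linarith)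
  have hsqrt1 : 1 ≤ Real.sqrt x := by rw [Real.le_sqrt (by norm_num) hx0.le]; linarith
  have hsqx : Real.sqrt x * Real.sqrt x = x := Real.mul_self_sqrt hx0.le
  have hsqrt_le : Real.sqrt x ≤ x := by nlinarith [Real.sqrt_nonneg x]
  have hD1 : 1 ≤ D := Nat.le_floor (by simpa using hsqrt1)
  have hDle : (D : ℝ) ≤ Real.sqrt x := Nat.floor_le (by positivity)
  have hDx : (D : ℝ) ^ 2 ≤ x := by nlinarith [Real.sqrt_nonneg x]
  have hDY : D ≤ Y := Nat.floor_le_floor hsqrt_le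
  have hYx : (Y : ℝ) ≤ x := Nat.floor_le hx0.le
  have hD1x : Real.sqrt x < (D : ℝ) + 1 := Nat.lt_floor_add_one _
  -- split at `D`
  rw [← Finset.sum_filter_add_sum_filter_not (Finset.Icc 1 Y) (fun d => d ≤ D)]
  have hs1 : (Finset.Icc 1 Y).filter (fun d => d ≤ D) = Finset.Icc 1 D := by
    ext d; simp only [Finset.mem_filter, Finset.mem_Icc]; omega
  have hs2 : (Finset.Icc 1 Y).filter (fun d => ¬ d ≤ D) = Finset.Icc (D + 1) Y := by
    ext d; simp only [Finset.mem_filter, Finset.mem_Icc]; omega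
  rw [hs1, hs2]
  -- Part 1: `d ≤ D`
  have hpart1 : ∑ d ∈ Finset.Icc 1 D, |Chebyshev.psi d - d| * kk x d ≤ (7.5 + 4.5 * C₂) * x := by
    have hstep : ∀ d ∈ Finset.Icc 1 D, |Chebyshev.psi d - d| * kk x d ≤
        x * (|Chebyshev.psi d - d| / (d * (d + 1))) + |Chebyshev.psi d - d| := by
      intro d hd
      rw [Finset.mem_Icc] at hd
      have hk := kk_le hx0.le hd.1
      have hd0 : (0 : ℝ) < d := by exact_mod_cast hd.1
      calc |Chebyshev.psi d - d| * kk x d ≤ |Chebyshev.psi d - d| * (x / (d * (d + 1)) + 1) :=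
            mul_le_mul_of_nonneg_left hk (abs_nonneg _)
        _ = x * (|Chebyshev.psi d - d| / (d * (d + 1))) + |Chebyshev.psi d - d| := by
            field_simp
    refine (Finset.sum_le_sum hstep).trans ?_
    rw [Finset.sum_add_distrib, ← Finset.mul_sum]
    -- (i) `∑ |ψ d - d| ≤ 7 D² ≤ 7x`
    have hi : ∑ d ∈ Finset.Icc 1 D, |Chebyshev.psi d - d| ≤ 7 * x := by
      calc ∑ d ∈ Finset.Icc 1 D, |Chebyshev.psi d - d| ≤ ∑ d ∈ Finset.Icc 1 D, 7 * (D : ℝ) := by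
            refine Finset.sum_le_sum fun d hd => (abs_psi_sub_le_mul d).trans ?_
            rw [Finset.mem_Icc] at hd
            gcongr; exact_mod_cast hd.2
        _ = 7 * (D : ℝ) ^ 2 := by simp; ring
        _ ≤ 7 * x := by linarith
    -- (ii) `∑ |ψ d - d|/(d(d+1)) ≤ 1/2 + 4.5 C₂`
    have hii : ∑ d ∈ Finset.Icc 1 D, |Chebyshev.psi d - d| / ((d : ℝ) * (d + 1)) ≤ 0.5 + 4.5 * C₂ := by
      rw [Finset.Icc_eq_cons_Ioc hD1, Finset.sum_cons]
      have h1 : |Chebyshev.psi ((1 : ℕ) : ℝ) - (1 : ℕ)| / (((1 : ℕ) : ℝ) * ((1 : ℕ) + 1)) = 0.5 := by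
        simp [Chebyshev.psi_one]; norm_num
      rw [h1]
      have h2 : ∑ d ∈ Finset.Ioc 1 D, |Chebyshev.psi d - d| / ((d : ℝ) * (d + 1)) ≤
          C₂ * ∑ d ∈ Finset.Icc 2 D, 1 / ((d : ℝ) * Real.log d ^ 2) := by
        rw [show Finset.Ioc 1 D = Finset.Icc 2 D by ext d; simp only [Finset.mem_Ioc, Finset.mem_Icc]; omega,
          Finset.mul_sum]
        refine Finset.sum_le_sum fun d hd => ?_
        rw [Finset.mem_Icc] at hd
        have hd2 : (2 : ℝ) ≤ d := by exact_mod_cast hd.1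
        have hd0 : (0 : ℝ) < d := by linarith
        have hl : 0 < Real.log d := Real.log_pos (by linarith)
        have hp := hpsi d hd.1
        calc |Chebyshev.psi d - d| / ((d : ℝ) * (d + 1)) ≤ (C₂ * d / Real.log d ^ 2) / ((d : ℝ) * (d + 1)) := by
              gcongr
          _ = C₂ / (((d : ℝ) + 1) * Real.log d ^ 2) := by field_simp
          _ ≤ C₂ / ((d : ℝ) * Real.log d ^ 2) := by
              apply div_le_div_of_nonneg_left hC₂ (by positivity)
              gcongr; linarith
          _ = C₂ * (1 / ((d : ℝ) * Real.log d ^ 2)) := by ring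
      have h3 := sum_inv_mul_log_sq_le D
      have h4 : C₂ * ∑ d ∈ Finset.Icc 2 D, 1 / ((d : ℝ) * Real.log d ^ 2) ≤ C₂ * (3 / Real.log 2) :=
        mul_le_mul_of_nonneg_left h3 hC₂
      have h5 : 3 / Real.log 2 ≤ 4.5 := by
        rw [div_le_iff₀ (by linarith)]; linarith
      nlinarith
    calc x * ∑ d ∈ Finset.Icc 1 D, |Chebyshev.psi d - d| / ((d : ℝ) * (d + 1)) +
          ∑ d ∈ Finset.Icc 1 D, |Chebyshev.psi d - d|
        ≤ x * (0.5 + 4.5 * C₂) + 7 * x := add_le_add (mul_le_mul_of_nonneg_left hii hx0.le) hi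
      _ = (7.5 + 4.5 * C₂) * x := by ring
  -- Part 2: `d > D`
  have hpart2 : ∑ d ∈ Finset.Icc (D + 1) Y, |Chebyshev.psi d - d| * kk x d ≤ 12 * C₂ * x := by
    have hL2 : 0 < L / 2 := by linarith
    have hlogd : ∀ d ∈ Finset.Icc (D + 1) Y, L / 2 ≤ Real.log d := by
      intro d hd
      rw [Finset.mem_Icc] at hd
      have : Real.sqrt x ≤ d := by
        have : ((D + 1 : ℕ) : ℝ) ≤ d := by exact_mod_cast hd.1
        push_cast at this; linarith
      calc L / 2 = Real.log (Real.sqrt x) := by rw [Real.log_sqrt hx0.le]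
        _ ≤ Real.log d := Real.log_le_log (by positivity) this
    have hψ : ∀ d ∈ Finset.Icc (D + 1) Y, |Chebyshev.psi d - d| ≤ (4 * C₂ / L ^ 2) * d := by
      intro d hd
      have hld := hlogd d hd
      rw [Finset.mem_Icc] at hd
      have hd2 : 2 ≤ d := by omega
      have hd0 : (0 : ℝ) < d := by exact_mod_cast (show 0 < d by omega)
      have hl0 : 0 < Real.log d := hL2.trans_le hld
      refine (hpsi d hd2).trans ?_
      rw [div_le_iff₀ (by positivity)]
      have : (L / 2) ^ 2 ≤ Real.log d ^ 2 := pow_le_pow_left₀ hL2.le hld 2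
      calc C₂ * d = (4 * C₂ / L ^ 2) * d * (L / 2) ^ 2 := by field_simp; ring
        _ ≤ (4 * C₂ / L ^ 2) * d * Real.log d ^ 2 := by gcongr
    -- `∑ d k_d ≤ 2x + xL`
    have hdk : ∑ d ∈ Finset.Icc (D + 1) Y, (d : ℝ) * kk x d ≤ 2 * x + x * L := by
      set F : ℕ → ℝ := fun d => (⌊x / d⌋₊ : ℝ) with hF
      have hkF : ∀ d : ℕ, kk x d = F d - F (d + 1) := by
        intro d; simp only [kk, hF]; push_cast; ring_nf
      simp_rw [hkF]
      rw [abel_sum_id F (D + 1) Y (by omega)]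
      have hFY : F (Y + 1) = 0 := by
        simp only [hF]
        rw [Nat.cast_eq_zero, Nat.floor_eq_zero, div_lt_one (by positivity), hY]
        exact_mod_cast Nat.lt_floor_add_one x
      have hF0 : ∀ d : ℕ, 1 ≤ d → F d ≤ x / d := fun d hd => Nat.floor_le (by positivity)
      have hA : ((D + 1 : ℕ) : ℝ) * F (D + 1) ≤ x := by
        have := hF0 (D + 1) (by omega)
        have hD0 : (0 : ℝ) < (D + 1 : ℕ) := by positivity
        calc ((D + 1 : ℕ) : ℝ) * F (D + 1) ≤ ((D + 1 : ℕ) : ℝ) * (x / (D + 1 : ℕ)) := by gcongr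
          _ = x := by field_simp
      have hB : ∑ d ∈ Finset.Icc (D + 1 + 1) (Y + 1), F d ≤ x * (Real.log ((Y + 1 : ℕ) : ℝ) - Real.log ((D + 1 : ℕ) : ℝ)) := by
        calc ∑ d ∈ Finset.Icc (D + 1 + 1) (Y + 1), F d ≤ ∑ d ∈ Finset.Icc (D + 1 + 1) (Y + 1), x * (1 / (d : ℝ)) := by
              refine Finset.sum_le_sum fun d hd => ?_
              rw [Finset.mem_Icc] at hd
              rw [mul_one_div]
              exact hF0 d (by omega)
          _ = x * ∑ d ∈ Finset.Icc (D + 1 + 1) (Y + 1), 1 / (d : ℝ) := by rw [Finset.mul_sum]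
          _ ≤ x * (Real.log ((Y + 1 : ℕ) : ℝ) - Real.log ((D + 1 : ℕ) : ℝ)) := by
              gcongr
              exact sum_Icc_inv_le_log (D + 1) (Y + 1) (by omega) (by omega)
      have hlogY : Real.log ((Y + 1 : ℕ) : ℝ) ≤ Real.log 2 + L := by
        have h1 : ((Y + 1 : ℕ) : ℝ) ≤ 2 * x := by push_cast; linarith
        calc Real.log ((Y + 1 : ℕ) : ℝ) ≤ Real.log (2 * x) := Real.log_le_log (by positivity) h1
          _ = Real.log 2 + L := by rw [Real.log_mul (by norm_num) hx0.ne']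
      have hlogD : L / 2 ≤ Real.log ((D + 1 : ℕ) : ℝ) := by
        calc L / 2 = Real.log (Real.sqrt x) := by rw [Real.log_sqrt hx0.le]
          _ ≤ Real.log ((D + 1 : ℕ) : ℝ) := Real.log_le_log (by positivity) (by push_cast; linarith)
      push_cast at hA hFY ⊢
      rw [hFY, mul_zero, sub_zero]
      have : x * (Real.log ((Y : ℝ) + 1) - Real.log ((D : ℝ) + 1)) ≤ x * (Real.log 2 + L - L / 2) := by
        push_cast at hlogY hlogD
        exact mul_le_mul_of_nonneg_left (by linarith) hx0.le
      push_cast at hB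
      nlinarith
    calc ∑ d ∈ Finset.Icc (D + 1) Y, |Chebyshev.psi d - d| * kk x d
        ≤ ∑ d ∈ Finset.Icc (D + 1) Y, (4 * C₂ / L ^ 2) * d * kk x d := by
          refine Finset.sum_le_sum fun d hd => ?_
          have hd1 : 1 ≤ d := by rw [Finset.mem_Icc] at hd; omega
          exact mul_le_mul_of_nonneg_right (hψ d hd) (kk_nonneg hx0.le hd1)
      _ = (4 * C₂ / L ^ 2) * ∑ d ∈ Finset.Icc (D + 1) Y, (d : ℝ) * kk x d := by
          rw [Finset.mul_sum]; exact Finset.sum_congr rfl fun d _ => by ring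
      _ ≤ (4 * C₂ / L ^ 2) * (2 * x + x * L) := by gcongr
      _ = 8 * C₂ * x / L ^ 2 + 4 * C₂ * x / L := by field_simp; ring
      _ ≤ 8 * C₂ * x + 4 * C₂ * x := by
          gcongr
          · exact div_le_self (by positivity) (one_le_pow₀ hL1)
          · exact div_le_self (by positivity) hL1
      _ = 12 * C₂ * x := by ring
  linarith

/-! ### From the sum `∑ ‖S(x/d)‖` to the integral `x ∫ ‖S(e^u)‖ e^{-u} du` -/

/-- The log-scale integrand `‖S(e^u)‖ e^{-u}`. [folklore] -/
def normSExp (g : ℕ → ℂ) (u : ℝ) : ℝ := ‖S g (Real.exp u)‖ * Real.exp (-u)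

/-- `u ↦ |S(e^u)| e^{-u}` is measurable. [folklore] -/
theorem measurable_normSExp (g : ℕ → ℂ) : Measurable (normSExp g) :=
  ((measurable_S g).comp Real.measurable_exp).norm.mul (Real.measurable_exp.comp measurable_neg)

/-- `|S(e^u)| e^{-u} ≤ 1` for `1`-bounded `g`. [folklore] -/
theorem normSExp_le_one (hgb : ∀ n, ‖g n‖ ≤ 1) (u : ℝ) : normSExp g u ≤ 1 := by
  have h := norm_S_le' hgb (Real.exp_pos u).le
  unfold normSExp
  calc ‖S g (Real.exp u)‖ * Real.exp (-u) ≤ Real.exp u * Real.exp (-u) := by gcongr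
    _ = 1 := by rw [← Real.exp_add]; simp

/-- `|S(e^u)| e^{-u} ≥ 0`. [folklore] -/
theorem normSExp_nonneg (g : ℕ → ℂ) (u : ℝ) : 0 ≤ normSExp g u := by unfold normSExp; positivity

/-- `u ↦ |S(e^u)| e^{-u}` is interval integrable (bounded measurable). [folklore] -/
theorem intervalIntegrable_normSExp (hgb : ∀ n, ‖g n‖ ≤ 1) (a b : ℝ) :
    IntervalIntegrable (normSExp g) volume a b := by
  refine IntervalIntegrable.mono_fun' (g := fun _ => (1 : ℝ)) intervalIntegrable_const
    (measurable_normSExp g).aestronglyMeasurable (Filter.Eventually.of_forall fun u => ?_)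
  show ‖normSExp g u‖ ≤ 1
  rw [Real.norm_of_nonneg (normSExp_nonneg g u)]
  exact normSExp_le_one hgb u

/-- The per-`d` inequality: for `1 ≤ d` and `x > 0`,
`‖S(x/d)‖ - k_d ≤ x ∫_{log(x/(d+1))}^{log(x/d)} ‖S(e^u)‖ e^{-u} du`. [folklore] -/
theorem norm_S_div_sub_kk_le (hgb : ∀ n, ‖g n‖ ≤ 1) (hx : 0 < x) {d : ℕ} (hd : 1 ≤ d) :
    ‖S g (x / d)‖ - kk x d ≤ x * ∫ u in Real.log (x / (d + 1))..Real.log (x / d), normSExp g u := by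
  have hd0 : (0 : ℝ) < d := by exact_mod_cast hd
  set α := Real.log (x / (d + 1)) with hα
  set β := Real.log (x / d) with hβ
  have hxd1 : 0 < x / (d + 1) := by positivity
  have hxd : 0 < x / d := by positivity
  have hle : x / (d + 1) ≤ x / d := div_le_div_of_nonneg_left hx.le hd0 (by linarith)
  have hαβ : α ≤ β := Real.log_le_log hxd1 hle
  -- pointwise lower bound on `[α, β]`
  have hpt : ∀ u ∈ Set.Icc α β, (‖S g (x / d)‖ - kk x d) * Real.exp (-u) ≤ normSExp g u := by
    intro u hu
    unfold normSExp
    refine mul_le_mul_of_nonneg_right ?_ (Real.exp_pos _).le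
    have hu1 : x / (d + 1) ≤ Real.exp u := by
      calc x / (d + 1) = Real.exp α := (Real.exp_log hxd1).symm
        _ ≤ Real.exp u := Real.exp_le_exp.mpr hu.1
    have hu2 : Real.exp u ≤ x / d := by
      calc Real.exp u ≤ Real.exp β := Real.exp_le_exp.mpr hu.2
        _ = x / d := Real.exp_log hxd
    have hfl1 : ⌊x / (d + 1)⌋₊ ≤ ⌊Real.exp u⌋₊ := Nat.floor_le_floor hu1
    have hfl2 : ⌊Real.exp u⌋₊ ≤ ⌊x / d⌋₊ := Nat.floor_le_floor hu2
    have hsub := norm_S_sub_S_le hgb hfl2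
    have htri : ‖S g (x / d)‖ ≤ ‖S g (Real.exp u)‖ + ‖S g (x / d) - S g (Real.exp u)‖ := by
      have := norm_add_le (S g (Real.exp u)) (S g (x / d) - S g (Real.exp u))
      rwa [add_sub_cancel] at this
    have hk : (⌊x / d⌋₊ : ℝ) - ⌊Real.exp u⌋₊ ≤ kk x d := by
      unfold kk
      have : (⌊x / (d + 1)⌋₊ : ℝ) ≤ ⌊Real.exp u⌋₊ := by exact_mod_cast hfl1
      linarith
    linarith
  -- integrate
  have hI : ∫ u in α..β, (‖S g (x / d)‖ - kk x d) * Real.exp (-u) =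
      (‖S g (x / d)‖ - kk x d) * ((d + 1) / x - d / x) := by
    rw [intervalIntegral.integral_const_mul]
    congr 1
    rw [intervalIntegral.integral_comp_neg (fun u => Real.exp u), integral_exp]
    rw [hα, hβ, Real.exp_neg, Real.exp_neg, Real.exp_log hxd1, Real.exp_log hxd, inv_div, inv_div]
  have hmono : ∫ u in α..β, (‖S g (x / d)‖ - kk x d) * Real.exp (-u) ≤ ∫ u in α..β, normSExp g u :=
    intervalIntegral.integral_mono_on hαβ ((continuous_const.mul (by fun_prop)).intervalIntegrable _ _)
      (intervalIntegrable_normSExp hgb _ _) hpt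
  rw [hI] at hmono
  have hx1 : (‖S g (x / d)‖ - kk x d) * ((d + 1) / x - d / x) = (‖S g (x / d)‖ - kk x d) / x := by
    field_simp; ring
  rw [hx1, div_le_iff₀ hx] at hmono
  linarith

/-- **Sum versus integral**: `∑_{d ≤ x} ‖S(x/d)‖ ≤ x ∫_0^{log x} ‖S(e^u)‖ e^{-u} du + ⌊x⌋ + 1`. [folklore] -/
theorem sum_norm_S_div_le (hgb : ∀ n, ‖g n‖ ≤ 1) (hx : 1 ≤ x) :
    ∑ d ∈ Finset.Icc 1 ⌊x⌋₊, ‖S g (x / d)‖ ≤ x * (∫ u in (0:ℝ)..Real.log x, normSExp g u) + ⌊x⌋₊ + 1 := by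
  have hx0 : 0 < x := by linarith
  set Y := ⌊x⌋₊ with hY
  have hY1 : 1 ≤ Y := Nat.le_floor (by simpa using hx)
  -- the break points `e k = log(x/(Y+1-k))`
  set e : ℕ → ℝ := fun k => Real.log (x / ((Y + 1 - k : ℕ) : ℝ)) with he
  have he0 : e 0 = Real.log (x / (Y + 1)) := by simp [he]
  have heY : e Y = Real.log x := by
    simp only [he]; rw [show Y + 1 - Y = 1 by omega]; simp
  -- per-`k` inequality
  have hk : ∀ k ∈ Finset.range Y,
      ‖S g (x / (Y - k : ℕ))‖ - kk x (Y - k) ≤ x * ∫ u in e k..e (k + 1), normSExp g u := by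
    intro k hkY
    rw [Finset.mem_range] at hkY
    have h := norm_S_div_sub_kk_le hgb hx0 (d := Y - k) (by omega)
    have h1 : Real.log (x / (((Y - k : ℕ) : ℝ) + 1)) = e k := by
      simp only [he]; congr 2; rw [show Y + 1 - k = (Y - k) + 1 by omega]; push_cast; ring
    have h2 : Real.log (x / ((Y - k : ℕ) : ℝ)) = e (k + 1) := by
      simp only [he]; congr 2; rw [show Y + 1 - (k + 1) = Y - k by omega]
    rw [h1, h2] at h
    exact h
  -- sum over `k`
  have hsum := Finset.sum_le_sum hk
  rw [← Finset.mul_sum, intervalIntegral.sum_integral_adjacent_intervals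
    (fun k _ => intervalIntegrable_normSExp hgb _ _), he0, heY] at hsum
  -- reindex the left-hand side
  have hreindex : ∑ k ∈ Finset.range Y, (‖S g (x / (Y - k : ℕ))‖ - kk x (Y - k)) =
      ∑ d ∈ Finset.Icc 1 Y, (‖S g (x / d)‖ - kk x d) := by
    have h1 := Finset.sum_range_reflect (fun k => ‖S g (x / ((k + 1 : ℕ) : ℝ))‖ - kk x (k + 1)) Y
    have h2 : ∀ k ∈ Finset.range Y, (‖S g (x / (((Y - 1 - k) + 1 : ℕ) : ℝ))‖ - kk x ((Y - 1 - k) + 1)) =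
        (‖S g (x / (Y - k : ℕ))‖ - kk x (Y - k)) := by
      intro k hkY
      rw [Finset.mem_range] at hkY
      rw [show Y - 1 - k + 1 = Y - k by omega]
    rw [← Finset.sum_congr rfl h2, h1, show Finset.Icc 1 Y = Finset.Ico 1 (1 + Y) by
      ext d; simp only [Finset.mem_Icc, Finset.mem_Ico]; omega, Finset.sum_Ico_eq_sum_range,
      Nat.add_sub_cancel_left]
    refine Finset.sum_congr rfl fun k _ => ?_
    rw [add_comm 1 k]
  rw [hreindex, Finset.sum_sub_distrib, sum_kk_eq Y hY] at hsum
  -- split the integral at `0`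
  have hsplit : ∫ u in Real.log (x / (Y + 1))..Real.log x, normSExp g u =
      (∫ u in Real.log (x / (Y + 1))..0, normSExp g u) + ∫ u in (0:ℝ)..Real.log x, normSExp g u :=
    (intervalIntegral.integral_add_adjacent_intervals (intervalIntegrable_normSExp hgb _ _)
      (intervalIntegrable_normSExp hgb _ _)).symm
  have hneg : Real.log (x / (Y + 1)) ≤ 0 := by
    apply Real.log_nonpos (by positivity)
    rw [div_le_one (by positivity), hY]
    exact (Nat.lt_floor_add_one x).le
  have hsmall : x * ∫ u in Real.log (x / (Y + 1))..0, normSExp g u ≤ 1 := by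
    have hbd : ∀ u ∈ Set.Icc (Real.log (x / (Y + 1))) 0, normSExp g u ≤ Real.exp (-u) := by
      intro u hu
      unfold normSExp
      have h1 : ‖S g (Real.exp u)‖ ≤ 1 := by
        refine (norm_S_le hgb _).trans ?_
        have : (⌊Real.exp u⌋₊ : ℝ) ≤ Real.exp u := Nat.floor_le (Real.exp_pos u).le
        have : Real.exp u ≤ 1 := Real.exp_le_one_iff.mpr hu.2
        linarith
      calc ‖S g (Real.exp u)‖ * Real.exp (-u) ≤ 1 * Real.exp (-u) := by gcongr
        _ = Real.exp (-u) := one_mul _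
    have hI : ∫ u in Real.log (x / (Y + 1))..0, normSExp g u ≤ ∫ u in Real.log (x / (Y + 1))..0, Real.exp (-u) :=
      intervalIntegral.integral_mono_on hneg (intervalIntegrable_normSExp hgb _ _)
        ((by fun_prop : Continuous fun u : ℝ => Real.exp (-u)).intervalIntegrable _ _) hbd
    have hval : ∫ u in Real.log (x / (Y + 1))..0, Real.exp (-u) = (Y + 1) / x - 1 := by
      rw [intervalIntegral.integral_comp_neg (fun u => Real.exp u), integral_exp, neg_zero, Real.exp_zero,
        Real.exp_neg, Real.exp_log (by positivity), inv_div]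
    rw [hval] at hI
    have hYx : (Y : ℝ) ≤ x := Nat.floor_le hx0.le
    calc x * ∫ u in Real.log (x / (Y + 1))..0, normSExp g u ≤ x * ((Y + 1) / x - 1) :=
          mul_le_mul_of_nonneg_left hI hx0.le
      _ = Y + 1 - x := by field_simp
      _ ≤ 1 := by linarith
  rw [hsplit, mul_add] at hsum
  linarith

/-- `∫_0^{log 2} ‖S(e^u)‖ e^{-u} du ≤ 1`. [folklore] -/
theorem integral_normSExp_small_le (hgb : ∀ n, ‖g n‖ ≤ 1) :
    ∫ u in (0:ℝ)..Real.log 2, normSExp g u ≤ 1 := by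
  have hlog2 : 0 ≤ Real.log 2 := Real.log_nonneg (by norm_num)
  have hlog2' : Real.log 2 ≤ 1 := by have := Real.log_two_lt_d9; linarith
  calc ∫ u in (0:ℝ)..Real.log 2, normSExp g u ≤ ∫ u in (0:ℝ)..Real.log 2, (1 : ℝ) :=
        intervalIntegral.integral_mono_on hlog2 (intervalIntegrable_normSExp hgb _ _) intervalIntegrable_const
          (fun u _ => normSExp_le_one hgb u)
    _ = Real.log 2 := by simp
    _ ≤ 1 := hlog2'

/-- **Lemma A2** (Granville–Soundararajan 2003, Lemma 2.1, (2.1), in logarithmic scale): there is an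
absolute `C` such that for every completely multiplicative `g` with `|g| ≤ 1` and every `x ≥ 3`,
`‖S(x)‖ log x ≤ x ∫_{log 2}^{log x} ‖S(e^u)‖ e^{-u} du + C x`
(i.e. `|S(x)| ≤ (x/log x) ∫_2^x |S(y)| y^{-2} dy + O(x/log x)`).
[cite: GranvilleSoundararajan2003, Lemma 2.1, (2.1)] -/
theorem exists_norm_S_mul_log_le_integral :
    ∃ C : ℝ, ∀ g : ℕ → ℂ, (∀ m n, g (m * n) = g m * g n) → (∀ n, ‖g n‖ ≤ 1) →
      ∀ x : ℝ, 3 ≤ x →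
        ‖S g x‖ * Real.log x ≤ x * (∫ u in Real.log 2..Real.log x, normSExp g u) + C * x := by
  obtain ⟨C, hC⟩ := exists_sum_abs_psi_sub_mul_kk_le
  refine ⟨C + 4, fun g hg hgb x hx => ?_⟩
  have hx1 : 1 ≤ x := by linarith
  have hx0 : 0 < x := by linarith
  have h1 := norm_S_mul_log_le hg hgb hx1
  have h2 := sum_vonMangoldt_mul_le (g := g) hgb hx1
  have h3 := hC x hx
  have h4 := sum_norm_S_div_le (g := g) hgb hx1
  have hYx : (⌊x⌋₊ : ℝ) ≤ x := Nat.floor_le hx0.le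
  have hsplit : ∫ u in (0:ℝ)..Real.log x, normSExp g u =
      (∫ u in (0:ℝ)..Real.log 2, normSExp g u) + ∫ u in Real.log 2..Real.log x, normSExp g u :=
    (intervalIntegral.integral_add_adjacent_intervals (intervalIntegrable_normSExp hgb _ _)
      (intervalIntegrable_normSExp hgb _ _)).symm
  have hsmall := integral_normSExp_small_le (g := g) hgb
  rw [hsplit] at h4
  have h5 : x * ∫ u in (0:ℝ)..Real.log 2, normSExp g u ≤ x := by
    calc x * ∫ u in (0:ℝ)..Real.log 2, normSExp g u ≤ x * 1 := mul_le_mul_of_nonneg_left hsmall hx0.le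
      _ = x := mul_one x
  nlinarith

end Halasz

end Literature.NumberTheory.LFunctions
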